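import Mathlib
import Literature.RingTheory.TwoVariableSeries.Basic
import Summits.ResolutionOfSingularities.ResolutionOfSingularities.Theorems.WeightedInvariantLocalWeightedDropMonicDescentLabels
import Summits.ResolutionOfSingularities.ResolutionOfSingularities.Theorems.WeightedInvariantLocalWeightedDropMonicDescentDefs

/-!
# `WeightedInvariant.LocalWeightedDrop`, sub-stub N4″: the POSITION / LOW-POINT / HYPERBOLIC trichotomy for well-prepared labels (piece T-6′, label side)

Crux item stmt-ResolutionOfSingularities-8899 `LocalWeightedDrop` (route `ResolutionOfSingularities/WeightedInvariant`), door
`WeightedConstruction` stmt-ResolutionOfSingularities-0571.  [OURS · L1 W4.3, chain w43, lead prover; first file of piece T-6′ (`monicDescentBridge`, the game bridge hT6 of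
`descends_of_pieces`) of `N4PRIME-PLAN.md` §11.]

`dichotomy_of_wellPrepared`: a WELL-PREPARED label `(L₀, L₁)` (char-free statement) is a position (`ord L₀ ≥ 3`, `ord L₁ ≥ 2`), OR its scaled Newton set
has a point of degree `≤ 1` (then the germ `z² + L₁z + L₀` is non-singular), OR its degree-2 initial data is HYPERBOLIC: `L₁` has an exponent of degree 1, or
`coeff (1,1) L₀ ≠ 0` (then in characteristic 2 the initial form `z² + ℓz + Q` is not a square: `IsHyperbolic`).  The excluded fourth possibility — all points of
degree ≤ 2 are the even points `(2,0)`, `(0,2)` — contradicts well-preparedness: the `(1,2)`- resp. `(2,1)`-minimal one is a solvable vertex.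
-/

set_option linter.dupNamespace false -- mandated namespace of this single-conjunct summit

noncomputable section

namespace Summit.ResolutionOfSingularities.ResolutionOfSingularities.Theorems

namespace MonicDescent

open MvPowerSeries Literature.RingTheory.TwoVariableSeries

variable {k : Type} [Field k]

/-- If `L₀` is not of order `> 2` then it has an exponent of degree `≤ 2` (and similarly for `L₁`, order `> 1`). -/
theorem exists_coeff_ne_zero_of_not_lt_order {A : MvPowerSeries (Fin 2) k} {m : ℕ} (h : ¬ (m : ℕ∞) < A.order) :
    ∃ d : Fin 2 →₀ ℕ, coeff d A ≠ 0 ∧ d 0 + d 1 ≤ m := by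
  by_contra hne
  push Not at hne
  apply h
  have hle : ((m + 1 : ℕ) : ℕ∞) ≤ A.order := by
    apply MvPowerSeries.le_order
    intro d hd
    by_contra hc
    have hlt := hne d hc
    have hdeg : Finsupp.degree d = d 0 + d 1 := by rw [Finsupp.degree_eq_sum]; simp [Fin.sum_univ_two]
    rw [hdeg] at hd
    have := Nat.cast_lt.mp hd
    omega
  exact lt_of_lt_of_le (by exact_mod_cast Nat.lt_succ_self m) hle

/-- THE TRICHOTOMY for well-prepared labels. -/
theorem dichotomy_of_wellPrepared {L₀ L₁ : MvPowerSeries (Fin 2) k} (hWP : WellPrepared L₀ L₁) :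
    IsPosition L₀ L₁ ∨ (∃ P ∈ newtonSet L₀ L₁, P 0 + P 1 ≤ 1) ∨
      (∃ a : Fin 2 →₀ ℕ, coeff a L₁ ≠ 0 ∧ a 0 + a 1 = 1) ∨ coeff (Finsupp.single 0 1 + Finsupp.single 1 1) L₀ ≠ 0 := by
  by_contra h
  push Not at h
  obtain ⟨hnpos, hlow, hlin, h11⟩ := h
  -- from `¬ IsPosition`, a low exponent of `L₀` or of `L₁`
  have hcases : (∃ d : Fin 2 →₀ ℕ, coeff d L₀ ≠ 0 ∧ d 0 + d 1 ≤ 2) ∨ (∃ a : Fin 2 →₀ ℕ, coeff a L₁ ≠ 0 ∧ a 0 + a 1 ≤ 1) := by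
    unfold IsPosition at hnpos
    rw [not_and_or] at hnpos
    rcases hnpos with h0 | h1
    · exact Or.inl (exists_coeff_ne_zero_of_not_lt_order h0)
    · exact Or.inr (exists_coeff_ne_zero_of_not_lt_order h1)
  rcases hcases with ⟨d, hd, hdeg⟩ | ⟨a, ha, hdeg⟩
  · -- an exponent `d` of `L₀` of degree ≤ 2; degree ≤ 1 is excluded, `(1,1)` is excluded: `d ∈ {(2,0), (0,2)}`
    have hd2 : d 0 + d 1 = 2 := by
      have := hlow d (Or.inl hd); omega
    have hd11 : ¬ (d 0 = 1 ∧ d 1 = 1) := by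
      rintro ⟨h0, h1⟩
      have : d = Finsupp.single 0 1 + Finsupp.single 1 1 := finsupp_fin2_ext (by simpa using h0) (by simpa using h1)
      rw [this] at hd
      exact hd h11
    -- the weight exposing `d`: `(1,2)` if `d = (2,0)`, `(2,1)` if `d = (0,2)`
    have hax : (d 0 = 2 ∧ d 1 = 0) ∨ (d 0 = 0 ∧ d 1 = 2) := by omega
    -- `d` is a vertex
    have hvert : IsVertex (newtonSet L₀ L₁) d := by
      refine ⟨Or.inl hd, ?_⟩
      rcases hax with ⟨h0, h1⟩ | ⟨h0, h1⟩
      · refine ⟨fun i => if i = 0 then 1 else 2, fun i => by fin_cases i <;> simp, fun Q hQ hQd => ?_⟩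
        have hQ2 := hlow Q hQ
        have hw : ∀ R : Fin 2 →₀ ℕ, Finsupp.weight (fun i : Fin 2 => if i = 0 then 1 else 2) R = R 0 + 2 * R 1 := by
          intro R; rw [Finsupp.weight_apply, Finsupp.sum_fintype _ _ (by simp)]; simp [Fin.sum_univ_two]; ring
        rw [hw, hw, h0, h1]
        have hne : ¬ (Q 0 = 2 ∧ Q 1 = 0) := by
          rintro ⟨hq0, hq1⟩; apply hQd
          exact finsupp_fin2_ext (by rw [hq0, h0]) (by rw [hq1, h1])
        omega
      · refine ⟨fun i => if i = 0 then 2 else 1, fun i => by fin_cases i <;> simp, fun Q hQ hQd => ?_⟩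
        have hQ2 := hlow Q hQ
        have hw : ∀ R : Fin 2 →₀ ℕ, Finsupp.weight (fun i : Fin 2 => if i = 0 then 2 else 1) R = 2 * R 0 + R 1 := by
          intro R; rw [Finsupp.weight_apply, Finsupp.sum_fintype _ _ (by simp)]; simp [Fin.sum_univ_two]; ring
        rw [hw, hw, h0, h1]
        have hne : ¬ (Q 0 = 0 ∧ Q 1 = 2) := by
          rintro ⟨hq0, hq1⟩; apply hQd
          exact finsupp_fin2_ext (by rw [hq0, h0]) (by rw [hq1, h1])
        omega
    -- hence odd: impossible
    rcases hWP d hvert with ⟨a, hda, ha⟩ | ⟨-, i, hi⟩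
    · apply absurd (hlin a ha)
      have h0 := congrArg (fun f : Fin 2 →₀ ℕ => f 0) hda
      have h1 := congrArg (fun f : Fin 2 →₀ ℕ => f 1) hda
      simp only [Finsupp.smul_apply, smul_eq_mul] at h0 h1
      omega
    · apply hi
      have : i = 0 ∨ i = 1 := by fin_cases i <;> simp
      rcases this with rfl | rfl <;> rcases hax with ⟨h0, h1⟩ | ⟨h0, h1⟩ <;> simp [h0, h1]
  · -- an exponent `a` of `L₁` of degree ≤ 1: degree 1 excluded, degree 0 gives the point `0` of degree 0
    have ha0 : a 0 + a 1 = 0 := by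
      have := hlin a ha; omega
    have := hlow (2 • a) (Or.inr ⟨a, rfl, ha⟩)
    simp only [Finsupp.smul_apply, smul_eq_mul] at this
    omega

end MonicDescent

end Summit.ResolutionOfSingularities.ResolutionOfSingularities.Theorems

end
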